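import Literature.AnabelianGeometry.AbsoluteAnabelian.AbsTopIII.Reconstruction
import HarnessLib

/-!
# [AbsTopIII] §1: two constructions on the model interface — disjoint union of models, and replacing the
# closed-point data — with the restriction of Thm. 1.9 / Cor. 1.10 along them

Mochizuki, *Topics in Absolute Anabelian Geometry III*, §1, Thm. 1.9 p. 37, Cor. 1.10 pp. 41–44 (manuscript
pages, lit key `paper:url-5493eb38cbb7`).  The comparison statements `Thm_1_9 M`, `Cor_1_10_i/ii/iii M`
(`Reconstruction.lean`, abc-iut-L4-t1) are predicates on a model `M : CurveModel` (`CurveModel.lean`: an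
INDEX TYPE of curves with, for each, base field, extension `1 → Δ → Π → G → 1`, function fields, closed
points …).  They quantify over ALL curves of the model ("for `X` a hyperbolic orbicurve … over …"), so they
RESTRICT along inclusions of index types.  This file records the two index-level constructions used to
assemble named models from parts (abc-iut cell, GAP B item GB-13: the local curves `X_v`, `C_v` of an
initial Θ-datum are adjoined to GB-07's global model `InitialThetaData.nfCurveModel`, whose closed-point
data are then supplied):

* `CurveModel.sum M₁ M₂` — the model on `M₁.Curve ⊕ M₂.Curve` (curvewise the data of `M₁` resp. `M₂`; no
  cofinite-open relation ACROSS the two summands), with `Thm_1_9.sum_inl/inr`, `Cor_1_10_i/ii/iii.sum_inl/inr`: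
  the SAME algorithm witnesses the statement for each summand;
* `CurveModel.PointData M` / `CurveModel.withPoints M Q` — the model with the same curves, fields and
  extensions but closed points, decomposition groups and NF-point predicate replaced by `Q`; and
  `Thm_1_9.of_withPoints_of_isEmpty`: if `M` records NO closed points (`M.Point U` empty — then clause (a) of
  `Thm_1_9 M` asks for the EMPTY set of NF-point decomposition groups), `Thm_1_9 (M.withPoints Q) → Thm_1_9 M`
  (forget the output (a) of the algorithm; (d), (e) are unchanged), and the same for `Cor_1_10_iii`.

Pure bookkeeping on the interface; no mathematical content of [AbsTopIII] is asserted; no `instance`, no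
notation.
-/

noncomputable section

open CategoryTheory
open scoped Classical

namespace Literature.AnabelianGeometry.AbsoluteAnabelian.AbsTopIII

universe u

/-! ### Forgetting the output (a) of a Thm-1.9 algorithm / (e) of a Cor-1.10 algorithm -/

namespace NFPortionAlgorithm

/-- The Thm-1.9 algorithm with the SAME fields (d), (e) and functoriality but output (a) (the set of NF-point
decomposition groups) replaced by `∅` on every input — used to restrict `Thm_1_9` to a model that records no
closed points. [cite: MochizukiAbsTopIII2015, Thm 1.9 (a) p.37] -/
def forgetPoints (A : NFPortionAlgorithm.{u}) : NFPortionAlgorithm.{u} where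
  obj E := { A.obj E with nfPointDecomp := ∅ }
  map e := ⟨(A.map e).constEquiv, (A.map e).funEquiv, (A.map e).comm⟩
  map_id E := A.map_id E
  map_comp e f := A.map_comp e f
  comap f hf := A.comap f hf
  comap_map e h x := A.comap_map e h x
  comapBase f hf := A.comapBase f hf

/-- `forgetPoints` outputs no NF-point decomposition groups. [cite: MochizukiAbsTopIII2015, Thm 1.9 (a) p.37] -/
@[simp] theorem forgetPoints_nfPointDecomp (A : NFPortionAlgorithm.{u}) (E : FundamentalExtension.{u}) :
    (A.forgetPoints.obj E).nfPointDecomp = ∅ := rfl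

/-- `forgetPoints` keeps the field (e) `k̄_NF`. [cite: MochizukiAbsTopIII2015, Thm 1.9 (e) p.38] -/
theorem forgetPoints_constField (A : NFPortionAlgorithm.{u}) (E : FundamentalExtension.{u}) :
    (A.forgetPoints.obj E).constField = (A.obj E).constField := rfl

/-- `forgetPoints` keeps the field (e) `K_{Z_NF}`. [cite: MochizukiAbsTopIII2015, Thm 1.9 (e) p.38] -/
theorem forgetPoints_functionField (A : NFPortionAlgorithm.{u}) (E : FundamentalExtension.{u}) :
    (A.forgetPoints.obj E).functionField = (A.obj E).functionField := rfl

end NFPortionAlgorithm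

namespace MLFReconstructionAlgorithm

/-- The Cor-1.10 algorithm with the SAME fields but output (e) (decomposition groups of closed points)
replaced by `∅`. [cite: MochizukiAbsTopIII2015, Cor 1.10 (e) p.43] -/
def forgetPoints (A : MLFReconstructionAlgorithm.{u}) : MLFReconstructionAlgorithm.{u} where
  obj E := { A.obj E with closedPointDecomp := ∅ }
  map e := ⟨(A.map e).baseEquiv, (A.map e).funEquiv, (A.map e).comm⟩
  map_id E := A.map_id E
  map_comp e f := A.map_comp e f
  comap f hf := A.comap f hf
  comap_map e h x := A.comap_map e h x

/-- `forgetPoints` outputs no closed-point decomposition groups. [cite: MochizukiAbsTopIII2015, Cor 1.10 (e) p.43] -/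
@[simp] theorem forgetPoints_closedPointDecomp (A : MLFReconstructionAlgorithm.{u}) (E : FundamentalExtension.{u}) :
    (A.forgetPoints.obj E).closedPointDecomp = ∅ := rfl

end MLFReconstructionAlgorithm

namespace CurveModel

/-! ### Replacing the closed-point data of a model -/

/-- Closed-point data for the curves of a model `M`: for each curve an index type of closed points, their
decomposition groups in `Π_U`, and the NF-point predicate (the `Point`/`decomp`/`IsNFPoint` fields of
`CurveModel`, Cor. 1.10 (e) p. 43 / Def. 1.7 (ii) p. 35, detached so that they can be supplied separately).
[cite: MochizukiAbsTopIII2015, Def 1.7 p.35] -/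
structure PointData (M : CurveModel.{u}) : Type (u + 1) where
  /-- the closed points of `U` -/
  Point : M.Curve → Type u
  /-- a decomposition group in `Π_U` of a closed point -/
  decomp : ∀ U, Point U → Subgroup (M.ext U).arith
  /-- Def. 1.7 (ii): the point is an NF-point -/
  IsNFPoint : ∀ U, Point U → Prop

/-- The closed-point data a model already carries. [cite: MochizukiAbsTopIII2015, Def 1.7 p.35] -/
def pointData (M : CurveModel.{u}) : M.PointData := ⟨M.Point, M.decomp, M.IsNFPoint⟩

/-- **The model `M` with its closed-point data replaced by `Q`** (same curves, base fields, extensions, cusps,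
function fields, NF-function fields, predicates). [cite: MochizukiAbsTopIII2015, Def 1.7 p.35] -/
def withPoints (M : CurveModel.{u}) (Q : M.PointData) : CurveModel.{u} :=
  { M with Point := Q.Point, decomp := Q.decomp, IsNFPoint := Q.IsNFPoint }

section WithPoints

variable (M : CurveModel.{u}) (Q : M.PointData)

/-- `withPoints` keeps the curves. [cite: MochizukiAbsTopIII2015, Def 1.7 p.35] -/
theorem withPoints_Curve : (M.withPoints Q).Curve = M.Curve := rfl
/-- `withPoints` keeps the base fields. [cite: MochizukiAbsTopIII2015, Def 1.7 p.35] -/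
theorem withPoints_base (U : M.Curve) : (M.withPoints Q).base U = M.base U := rfl
/-- `withPoints` keeps the extensions. [cite: MochizukiAbsTopIII2015, Def 1.7 p.35] -/
theorem withPoints_ext (U : M.Curve) : (M.withPoints Q).ext U = M.ext U := rfl
/-- `withPoints` installs the new closed points. [cite: MochizukiAbsTopIII2015, Def 1.7 p.35] -/
theorem withPoints_Point (U : M.Curve) : (M.withPoints Q).Point U = Q.Point U := rfl
/-- `withPoints` installs the new decomposition groups. [cite: MochizukiAbsTopIII2015, Def 1.7 p.35] -/
theorem withPoints_decomp (U : M.Curve) (x : Q.Point U) : (M.withPoints Q).decomp U x = Q.decomp U x := rfl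
/-- `withPoints` installs the new NF-point predicate. [cite: MochizukiAbsTopIII2015, Def 1.7 p.35] -/
theorem withPoints_IsNFPoint (U : M.Curve) (x : Q.Point U) :
    (M.withPoints Q).IsNFPoint U x = Q.IsNFPoint U x := rfl
/-- `withPoints` keeps the Thm-1.9 input class. [cite: MochizukiAbsTopIII2015, Thm 1.9 p.37] -/
theorem withPoints_isThm19Input (U : M.Curve) : (M.withPoints Q).IsThm19Input U ↔ M.IsThm19Input U := Iff.rfl
/-- `withPoints` keeps the Cor-1.10 input class. [cite: MochizukiAbsTopIII2015, Cor 1.10 p.41] -/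
theorem withPoints_isCor110Input (U : M.Curve) : (M.withPoints Q).IsCor110Input U ↔ M.IsCor110Input U :=
  Iff.rfl

end WithPoints

/-! ### Disjoint union of two models -/

/-- **The disjoint union of two models**: index type `M₁.Curve ⊕ M₂.Curve`, each curve with its data from
`M₁` resp. `M₂`; `IsCofiniteOpen` holds only inside a summand (the two families of curves are unrelated).
[cite: MochizukiAbsTopIII2015, Prop 1.4 p.31] -/
def sum (M₁ M₂ : CurveModel.{u}) : CurveModel.{u} where
  Curve := M₁.Curve ⊕ M₂.Curve
  base := fun
    | .inl U => M₁.base U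
    | .inr U => M₂.base U
  instField := fun
    | .inl U => M₁.instField U
    | .inr U => M₂.instField U
  instCharZero := fun
    | .inl U => M₁.instCharZero U
    | .inr U => M₂.instCharZero U
  ext := fun
    | .inl U => M₁.ext U
    | .inr U => M₂.ext U
  galIso := fun
    | .inl U => M₁.galIso U
    | .inr U => M₂.galIso U
  cusps := fun
    | .inl U => M₁.cusps U
    | .inr U => M₂.cusps U
  IsProper := fun
    | .inl U => M₁.IsProper U
    | .inr U => M₂.IsProper U
  IsScheme := fun
    | .inl U => M₁.IsScheme U
    | .inr U => M₂.IsScheme U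
  genus := fun
    | .inl U => M₁.genus U
    | .inr U => M₂.genus U
  FunctionField := fun
    | .inl U => M₁.FunctionField U
    | .inr U => M₂.FunctionField U
  instFunctionField := fun
    | .inl U => M₁.instFunctionField U
    | .inr U => M₂.instFunctionField U
  instAlgebra := fun
    | .inl U => M₁.instAlgebra U
    | .inr U => M₂.instAlgebra U
  Point := fun
    | .inl U => M₁.Point U
    | .inr U => M₂.Point U
  decomp := fun
    | .inl U => M₁.decomp U
    | .inr U => M₂.decomp U
  IsNFCurve := fun
    | .inl U => M₁.IsNFCurve U
    | .inr U => M₂.IsNFCurve U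
  IsNFPoint := fun
    | .inl U => M₁.IsNFPoint U
    | .inr U => M₂.IsNFPoint U
  IsNFRational := fun
    | .inl U => M₁.IsNFRational U
    | .inr U => M₂.IsNFRational U
  IsNFConstant := fun
    | .inl U => M₁.IsNFConstant U
    | .inr U => M₂.IsNFConstant U
  NFFunctionField := fun
    | .inl U => M₁.NFFunctionField U
    | .inr U => M₂.NFFunctionField U
  instNFFunctionField := fun
    | .inl U => M₁.instNFFunctionField U
    | .inr U => M₂.instNFFunctionField U
  IsStrictlyBelyiType := fun
    | .inl U => M₁.IsStrictlyBelyiType U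
    | .inr U => M₂.IsStrictlyBelyiType U
  IsCofiniteOpen := fun
    | .inl U, .inl U' => M₁.IsCofiniteOpen U U'
    | .inr U, .inr U' => M₂.IsCofiniteOpen U U'
    | .inl _, .inr _ => False
    | .inr _, .inl _ => False
  res := fun {U U'} => match U, U' with
    | .inl _, .inl _ => fun h => M₁.res h
    | .inr _, .inr _ => fun h => M₂.res h
    | .inl _, .inr _ => fun h => h.elim
    | .inr _, .inl _ => fun h => h.elim

section Sum

variable (M₁ M₂ : CurveModel.{u})

/-- A curve of the first summand keeps its base field. [cite: MochizukiAbsTopIII2015, Prop 1.4 p.31] -/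
theorem sum_base_inl (U : M₁.Curve) : (M₁.sum M₂).base (.inl U) = M₁.base U := rfl
/-- A curve of the second summand keeps its base field. [cite: MochizukiAbsTopIII2015, Prop 1.4 p.31] -/
theorem sum_base_inr (U : M₂.Curve) : (M₁.sum M₂).base (.inr U) = M₂.base U := rfl
/-- A curve of the first summand keeps its extension. [cite: MochizukiAbsTopIII2015, Prop 1.4 p.31] -/
theorem sum_ext_inl (U : M₁.Curve) : (M₁.sum M₂).ext (.inl U) = M₁.ext U := rfl
/-- A curve of the second summand keeps its extension. [cite: MochizukiAbsTopIII2015, Prop 1.4 p.31] -/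
theorem sum_ext_inr (U : M₂.Curve) : (M₁.sum M₂).ext (.inr U) = M₂.ext U := rfl
/-- A curve of the first summand keeps its function field. [cite: MochizukiAbsTopIII2015, Prop 1.4 p.31] -/
theorem sum_FunctionField_inl (U : M₁.Curve) : (M₁.sum M₂).FunctionField (.inl U) = M₁.FunctionField U := rfl
/-- A curve of the second summand keeps its function field. [cite: MochizukiAbsTopIII2015, Prop 1.4 p.31] -/
theorem sum_FunctionField_inr (U : M₂.Curve) : (M₁.sum M₂).FunctionField (.inr U) = M₂.FunctionField U := rfl
/-- A curve of the first summand keeps its closed points. [cite: MochizukiAbsTopIII2015, Prop 1.4 p.31] -/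
theorem sum_Point_inl (U : M₁.Curve) : (M₁.sum M₂).Point (.inl U) = M₁.Point U := rfl
/-- A curve of the second summand keeps its closed points. [cite: MochizukiAbsTopIII2015, Prop 1.4 p.31] -/
theorem sum_Point_inr (U : M₂.Curve) : (M₁.sum M₂).Point (.inr U) = M₂.Point U := rfl
/-- The Thm-1.9 input class on the first summand. [cite: MochizukiAbsTopIII2015, Thm 1.9 p.37] -/
theorem sum_isThm19Input_inl (U : M₁.Curve) : (M₁.sum M₂).IsThm19Input (.inl U) ↔ M₁.IsThm19Input U :=
  Iff.rfl
/-- The Thm-1.9 input class on the second summand. [cite: MochizukiAbsTopIII2015, Thm 1.9 p.37] -/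
theorem sum_isThm19Input_inr (U : M₂.Curve) : (M₁.sum M₂).IsThm19Input (.inr U) ↔ M₂.IsThm19Input U :=
  Iff.rfl
/-- The Cor-1.10 input class on the first summand. [cite: MochizukiAbsTopIII2015, Cor 1.10 p.41] -/
theorem sum_isCor110Input_inl (U : M₁.Curve) : (M₁.sum M₂).IsCor110Input (.inl U) ↔ M₁.IsCor110Input U :=
  Iff.rfl
/-- The Cor-1.10 input class on the second summand. [cite: MochizukiAbsTopIII2015, Cor 1.10 p.41] -/
theorem sum_isCor110Input_inr (U : M₂.Curve) : (M₁.sum M₂).IsCor110Input (.inr U) ↔ M₂.IsCor110Input U :=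
  Iff.rfl

end Sum

end CurveModel

/-! ### Restriction of Thm. 1.9 / Cor. 1.10 along the two constructions -/

section Restrict

variable {M₁ M₂ : CurveModel.{u}}

/-- `Thm_1_9` for a disjoint union restricts to the first summand (same algorithm).
[cite: MochizukiAbsTopIII2015, Thm 1.9 p.37] -/
theorem Thm_1_9.sum_inl (h : Thm_1_9 (M₁.sum M₂)) : Thm_1_9 M₁ := by
  obtain ⟨A, hA⟩ := h
  exact ⟨A, fun X hX => hA (.inl X) hX⟩

/-- `Thm_1_9` for a disjoint union restricts to the second summand (same algorithm).
[cite: MochizukiAbsTopIII2015, Thm 1.9 p.37] -/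
theorem Thm_1_9.sum_inr (h : Thm_1_9 (M₁.sum M₂)) : Thm_1_9 M₂ := by
  obtain ⟨A, hA⟩ := h
  exact ⟨A, fun X hX => hA (.inr X) hX⟩

/-- `Cor_1_10_iii` for a disjoint union restricts to the first summand. [cite: MochizukiAbsTopIII2015, Cor 1.10 (iii) p.43] -/
theorem Cor_1_10_iii.sum_inl (h : Cor_1_10_iii (M₁.sum M₂)) : Cor_1_10_iii M₁ := by
  obtain ⟨A, hA⟩ := h
  exact ⟨A, fun X hX hB => hA (.inl X) hX hB⟩

/-- `Cor_1_10_iii` for a disjoint union restricts to the second summand. [cite: MochizukiAbsTopIII2015, Cor 1.10 (iii) p.43] -/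
theorem Cor_1_10_iii.sum_inr (h : Cor_1_10_iii (M₁.sum M₂)) : Cor_1_10_iii M₂ := by
  obtain ⟨A, hA⟩ := h
  exact ⟨A, fun X hX hB => hA (.inr X) hX hB⟩

/-- `Cor_1_10_ii` for a disjoint union restricts to the first summand. [cite: MochizukiAbsTopIII2015, Cor 1.10 (ii) p.42] -/
theorem Cor_1_10_ii.sum_inl (h : Cor_1_10_ii (M₁.sum M₂)) : Cor_1_10_ii M₁ := by
  obtain ⟨A, hA⟩ := h
  exact ⟨A, fun X hX => hA (.inl X) hX⟩

/-- `Cor_1_10_ii` for a disjoint union restricts to the second summand. [cite: MochizukiAbsTopIII2015, Cor 1.10 (ii) p.42] -/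
theorem Cor_1_10_ii.sum_inr (h : Cor_1_10_ii (M₁.sum M₂)) : Cor_1_10_ii M₂ := by
  obtain ⟨A, hA⟩ := h
  exact ⟨A, fun X hX => hA (.inr X) hX⟩

/-- `Cor_1_10_i` for a disjoint union restricts to the first summand. [cite: MochizukiAbsTopIII2015, Cor 1.10 (i) p.42] -/
theorem Cor_1_10_i.sum_inl (h : Cor_1_10_i (M₁.sum M₂)) : Cor_1_10_i M₁ := by
  obtain ⟨A, hA⟩ := h
  exact ⟨A, fun X hX => hA (.inl X) hX⟩

/-- `Cor_1_10_i` for a disjoint union restricts to the second summand. [cite: MochizukiAbsTopIII2015, Cor 1.10 (i) p.42] -/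
theorem Cor_1_10_i.sum_inr (h : Cor_1_10_i (M₁.sum M₂)) : Cor_1_10_i M₂ := by
  obtain ⟨A, hA⟩ := h
  exact ⟨A, fun X hX => hA (.inr X) hX⟩

variable {M : CurveModel.{u}} {Q : M.PointData}

/-- If a model records NO closed points, `Thm_1_9` for any closed-point enrichment of it gives `Thm_1_9` for
it: run the same algorithm and forget its output (a) (which the point-free model asks to be empty); the field
isomorphisms (d), (e) are untouched. [cite: MochizukiAbsTopIII2015, Thm 1.9 p.37] -/
theorem Thm_1_9.of_withPoints_of_isEmpty (h : Thm_1_9 (M.withPoints Q)) (hM : ∀ U, IsEmpty (M.Point U)) :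
    Thm_1_9 M := by
  obtain ⟨A, hA⟩ := h
  refine ⟨A.forgetPoints, fun X hX => ?_⟩
  obtain ⟨-, h2, h3⟩ := hA X hX
  refine ⟨?_, h2, h3⟩
  rw [NFPortionAlgorithm.forgetPoints_nfPointDecomp, eq_comm, Set.eq_empty_iff_forall_notMem]
  rintro D ⟨x, -, -, -⟩
  exact (hM X).false x

/-- The same for `Cor_1_10_iii`: forget output (e). [cite: MochizukiAbsTopIII2015, Cor 1.10 (iii) p.43] -/
theorem Cor_1_10_iii.of_withPoints_of_isEmpty (h : Cor_1_10_iii (M.withPoints Q))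
    (hM : ∀ U, IsEmpty (M.Point U)) : Cor_1_10_iii M := by
  obtain ⟨A, hA⟩ := h
  refine ⟨A.forgetPoints, fun X hX hB => ?_⟩
  obtain ⟨h1, -⟩ := hA X hX hB
  refine ⟨h1, ?_⟩
  rw [MLFReconstructionAlgorithm.forgetPoints_closedPointDecomp, eq_comm, Set.eq_empty_iff_forall_notMem]
  rintro D ⟨x, -, -⟩
  exact (hM X).false x

/-- `Cor_1_10_ii` does not mention closed points: it is insensitive to `withPoints`.
[cite: MochizukiAbsTopIII2015, Cor 1.10 (ii) p.42] -/
theorem Cor_1_10_ii.of_withPoints (h : Cor_1_10_ii (M.withPoints Q)) : Cor_1_10_ii M := h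

/-- `Cor_1_10_i` does not mention closed points: it is insensitive to `withPoints`.
[cite: MochizukiAbsTopIII2015, Cor 1.10 (i) p.42] -/
theorem Cor_1_10_i.of_withPoints (h : Cor_1_10_i (M.withPoints Q)) : Cor_1_10_i M := h

end Restrict

end Literature.AnabelianGeometry.AbsoluteAnabelian.AbsTopIII

end
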